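import Literature.IUT.HodgeArakelov.LabelClassesOfCuspsCor24iProofs3

/-!
# [IUTchII] Cor 2.4 (i) over the tower↔[IUTchI] §2 agreement — ONE `ℍ`-dictionary PER `□` (repair of part 3's assembly)

S. Mochizuki, *Inter-universal Teichmüller theory II*, kurims manuscript (Dec. 2020), §2: Remark 2.1.1 (ii) p. 65
(`Γ^▶_X ⊆ Γ_X` "the unique connected subgraph … stabilized by `ι_X` and contains every vertex of `Γ_X`"), Definition 2.3 (iv)
p. 68 (`Γ^{•t}_X ⊆ Γ^▶_X` "the connected subgraph with no edges whose unique vertex is the vertex determined by `t`";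
`Π_{v•t} ⊆ Π_{v▶} ⊆ Π_v`), Corollary 2.4 (i) pp. 69–71 ([IUTchII] Cor 2.4 (i), kurims pp.69-71)
[claim: Mochizuki2012, status: disputed] (D-0012 claim key; series status DISPUTED — every [IUTchI]/[IUTchII] input below is
a HYPOTHESIS named by the tree's typed predicates; nothing printed is asserted).

PROOF-ONLY repair companion (abc-iut cell, seat abc-iut-w4-d012 gen 2; node `IUTchII:Cor2.4(i)`; no definitions) of this
seat's own part 3, `LabelClassesOfCuspsCor24iProofs3.lean` (p414109).

FINDING (F-w4d012-2, vacuity-at-model, on this lineage's OWN closing theorem `cor24_i'_of_agreement` and inherited by the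
sub-DAG assembly `cor24_ii_iii'_of_agreement` of abc-iut-w5-d184).  Both bind
`Dic : ∀ H, Cor24_family Dec Ld H → A.SubgraphDictionary H` for ONE agreement `A : W.StableCurveAgreement C Dsc`, i.e. ONE
[IUTchI] §2 datum `Dsc : StableCurveTemperedData` — whose sub-graph `ℍ` is BAKED IN (`Dsc.deltaTpH = Δ^tp_{X,ℍ}`).  An
`ℍ`-dictionary `A.SubgraphDictionary H` identifies `Δ^±_{v□} ⊆ Π̂^±_v` with THAT `Δ^tp_{X,ℍ}`; so two dictionaries over
the same agreement force `Δ^±_{v□₁} = Δ^±_{v□₂}` (`deltaPmBox_eq_of_subgraphDictionary`, kernel), and `Dic` over the whole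
printed family `□ ∈ {▶} ∪ {•t}` forces all the `Δ^±_{v□}` to COINCIDE — whereas at the intended model `Γ^{•t}_X ⊊ Γ^▶_X`
(one vertex vs. all `2l⋇ + 1` vertices, Rmk 2.1.1 (ii) / Def 2.3 (iv)), so `Δ_{v•t} ⊊ Δ_{v▶}` and `Δ^±_{v•t} ≠ Δ^±_{v▶}`.
Hence `Dic` (with a single `Dsc`) is jointly UNSATISFIABLE at the model as soon as the family has two members: the part-3
assembly is sound as a proof term but uninstantiable there.  The same holds for a family of `Π`-level dictionaries
`A.PiSubgraphDictionary H` over one agreement (`pmBox_eq_of_piSubgraphDictionary`).  abc-iut-L6-t7's STRUCTURES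
`SubgraphDictionary` / `PiSubgraphDictionary` (one `H` at a time) are NOT at fault; the defect is the consumers'
quantification over the family with a fixed `Dsc`.

REPAIR (consumer-side restatement, as print does it — "[IUTchI], Corollary 2.3 applied with `X = X_v`, `ℍ = Γ_□`" for EACH
`□`): one [IUTchI] §2 datum and agreement PER admissible `Π_{v□}`:
`Dic : ∀ H, Cor24_family Dec Ld H → ∃ (D' : StableCurveTemperedData) (A' : W.StableCurveAgreement C D'),
  A'.SubgraphDictionary H ∧ D'.Cor23ii ∧ D'.Cor23v`,
input (A) still coming from the single `(A, Dsc.Prop24i, hΛ)` — theorem `cor24_i'_of_agreements` below (PROVED; the old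
`cor24_i'_of_agreement` is its special case `D' := Dsc, A' := A` — consumers switch by supplying
`⟨Dsc, A, Dic H hH, h23ii, h23vD⟩`; no twin of the old statement is re-declared here).

* `StableCurveAgreement.deltaPmBox_eq_of_subgraphDictionary` — kernel certificate of the collapse; PROVED.
* `StableCurveAgreement.pmBox_eq_of_piSubgraphDictionary` — the `Π`-level analogue; PROVED.
* `StableCurveAgreement.deltaBox_eq_of_subgraphDictionary` — with the Def. 2.3 (i)/(iv) equalities `Π^±_{v□} ∩ Π_v = Π_{v□}`
  the collapse descends to `Δ_{v□₁} = Δ_{v□₂}`; PROVED.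
* `not_forall_subgraphDictionary_of_deltaPmBox_ne` — the vacuity statement for the family; PROVED.
* `cor24_i'_of_agreements` — the REPAIRED node-level closing theorem; PROVED.

Nothing here takes a side on [IUTchIII] Cor. 3.12; typed ≠ discharged (the L5 predicates `Prop24i`, `Cor23ii`, `Cor23v`,
the agreements, `hΛ` and the open-subgroup step `h23vi` (GAP-LEDGER G-w4d012-2) are hypotheses).
-/

namespace Literature.IUT.HodgeArakelov

namespace PlusMinusTower

namespace StableCurveAgreement

open Literature.IUT.HodgeTheaters Literature.AnabelianGeometry.SemiGraphs

universe u

variable {S : BadPlaceSetting.{u}} {P : TopGroup.{u}} {T : TemperedCoverings S P}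
  {W : PlusMinusTower T} {C : CuspidalInertiaData W} {D : StableCurveTemperedData.{u}}

/-- **IUTchII:Cor2.4(i)** (kurims p.69; Def 2.3 (i) p.67) **Kernel certificate of the collapse.**  Two `ℍ`-dictionaries
over ONE agreement (hence one [IUTchI] §2 datum `D`, one sub-graph `ℍ`) force `Δ^±_{v□₁} = Δ^±_{v□₂}`: both are carried by
the injective `eHat` onto the same `Δ^tp_{X,ℍ} ⊆ Π̂_{X_v}`.  PROVED. [claim: Mochizuki2012, status: disputed] -/
theorem deltaPmBox_eq_of_subgraphDictionary (A : StableCurveAgreement W C D) {H₁ H₂ : Subgroup P}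
    (D₁ : A.SubgraphDictionary H₁) (D₂ : A.SubgraphDictionary H₂) : W.deltaPmBox H₁ = W.deltaPmBox H₂ := by
  have key : (W.deltaPmBox H₁).subgroupOf W.pmHat = (W.deltaPmBox H₂).subgroupOf W.pmHat :=
    Subgroup.map_injective A.eHat.injective (D₁.deltaPmBox_eq.trans D₂.deltaPmBox_eq.symm)
  rw [← Subgroup.map_subgroupOf_eq_of_le (W.deltaPmBox_le_pmHat H₁), key,
    Subgroup.map_subgroupOf_eq_of_le (W.deltaPmBox_le_pmHat H₂)]

/-- **IUTchII:Cor2.4(i)** (kurims p.69; Def 2.3 (i) p.67) The `Π`-level analogue: two `Π`-level dictionaries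
(`PiSubgraphDictionary`, abc-iut-L6-t7 B13 v2) over ONE agreement force `Π^±_{v□₁} = Π^±_{v□₂}` (both are carried onto the
same `Π^tp_{X,ℍ}`).  PROVED. [claim: Mochizuki2012, status: disputed] -/
theorem pmBox_eq_of_piSubgraphDictionary (A : StableCurveAgreement W C D) {H₁ H₂ : Subgroup P}
    (D₁ : A.PiSubgraphDictionary H₁) (D₂ : A.PiSubgraphDictionary H₂) : W.pmBox H₁ = W.pmBox H₂ := by
  have hle : ∀ H : Subgroup P, W.pmBox H ≤ W.pmHat := fun H => (W.pmNormalizer_le_piPM H).trans W.emb_le_pmHat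
  have key : (W.pmBox H₁).subgroupOf W.pmHat = (W.pmBox H₂).subgroupOf W.pmHat :=
    Subgroup.map_injective A.eHat.injective (D₁.pmBox_eq.trans D₂.pmBox_eq.symm)
  rw [← Subgroup.map_subgroupOf_eq_of_le (hle H₁), key, Subgroup.map_subgroupOf_eq_of_le (hle H₂)]

/-- **IUTchII:Cor2.4(i)** (kurims p.69; Def 2.3 (i)/(iv) pp.67–68) With the printed equalities `Π^±_{v□} ∩ Π_v = Π_{v□}`
(Def. 2.3 (i) for `□ = ▶`, Def. 2.3 (iv) for `□ = •t`; hypotheses `hcap₁`, `hcap₂`) the collapse descends to the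
decomposition groups themselves: `Δ_{v□₁} = Δ_{v□₂}` — at the intended model `Δ_{v•t} ⊊ Δ_{v▶}` (`Γ^{•t}_X` has one
vertex, `Γ^▶_X` all `2l⋇+1` of them, Rmk. 2.1.1 (ii) p.65), so this exhibits the unsatisfiability.  PROVED.
[claim: Mochizuki2012, status: disputed] -/
theorem deltaBox_eq_of_subgraphDictionary (A : StableCurveAgreement W C D) {H₁ H₂ : Subgroup P}
    (D₁ : A.SubgraphDictionary H₁) (D₂ : A.SubgraphDictionary H₂)
    (hcap₁ : W.pmBox H₁ ⊓ W.piV = W.box H₁) (hcap₂ : W.pmBox H₂ ⊓ W.piV = W.box H₂) :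
    W.deltaBox H₁ = W.deltaBox H₂ := by
  have e : ∀ H : Subgroup P, W.pmBox H ⊓ W.piV = W.box H → W.deltaBox H = W.deltaPmBox H ⊓ W.piV := by
    intro H hcap
    show W.box H ⊓ W.aug.ker = W.pmNormalizer H ⊓ W.aug.ker ⊓ W.piV
    rw [inf_right_comm, ← hcap]
  rw [e H₁ hcap₁, e H₂ hcap₂, A.deltaPmBox_eq_of_subgraphDictionary D₁ D₂]

end StableCurveAgreement

end PlusMinusTower

/-! ### The vacuity statement and the repaired assembly -/

section Assembly

open Literature.IUT.HodgeTheaters Literature.AnabelianGeometry.SemiGraphs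

universe u

variable {S : BadPlaceSetting.{u}} {P : TopGroup.{u}} {T : TemperedCoverings S P}
  {D : EtaleThetaData S.toThetaSetting P} {Dsc : StableCurveTemperedData.{u}}
  (Dec : SubgraphDecomposition S T D) (W : PlusMinusTower T) (C : CuspidalInertiaData W)
  {L : LabCuspStructure C} (Ld : LabelledDecomposition Dec L) (I : Subgroup W.Corhat)

/-- **IUTchII:Cor2.4(i)** (kurims pp.69–71) **Vacuity of the single-datum dictionary family.**  If two admissible
`Π_{v□₁}, Π_{v□₂}` (`Cor24_family`) have `Δ^±_{v□₁} ≠ Δ^±_{v□₂}` — the intended situation for `□₁ = ▶`, `□₂ = •t`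
(Rmk. 2.1.1 (ii) p.65, Def. 2.3 (iv) p.68) — then NO single agreement carries an `ℍ`-dictionary for every member of the
family: the hypothesis `Dic` of part 3's `cor24_i'_of_agreement` cannot be instantiated.  PROVED.
[claim: Mochizuki2012, status: disputed] -/
theorem not_forall_subgraphDictionary_of_deltaPmBox_ne (A : W.StableCurveAgreement C Dsc) {H₁ H₂ : Subgroup P}
    (h₁ : Cor24_family Dec Ld H₁) (h₂ : Cor24_family Dec Ld H₂) (hne : W.deltaPmBox H₁ ≠ W.deltaPmBox H₂) :
    ¬ ∀ H : Subgroup P, Cor24_family Dec Ld H → A.SubgraphDictionary H :=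
  fun Dic => hne (A.deltaPmBox_eq_of_subgraphDictionary (Dic H₁ h₁) (Dic H₂ h₂))

/-- **IUTchII:Cor2.4(i)′ from the agreement, ONE [IUTchI] §2 datum PER admissible `Π_{v□}`** (kurims pp.69–71; the
REPAIRED node-level closing theorem).  For a subgroup `I ⊆ Δ̂^cor_v` containing (through the agreement `A`) a nontrivial
compact pro-`Σ` subgroup of `Δ^tp_{X_v}` (`hΛ`, Rmk. 2.4.1 p.71), the decl of record `Cor24_i'` follows from: the agreement
`A` with [IUTchI] Prop. 2.4 (i) (`Dsc.Prop24i`) — input (A); and, for EACH admissible `Π_{v□}` (`Cor24_family`), SOME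
[IUTchI] §2 datum `D'` ("`X = X_v`, `ℍ = Γ_□`") with an agreement `A'`, its `ℍ`-dictionary and [IUTchI] Cor. 2.3 (ii), (v)
(`D'.Cor23ii`, `D'.Cor23v`) — input (C) via abc-iut-L6-t7's `StableCurveAgreement.h23v`; plus the open-subgroup step (B)
(`h23vi`, GAP-LEDGER G-w4d012-2).  ALL HYPOTHESES, never asserted.  PROVED (assembly of `cor24_i'_of_inputs`,
`StableCurveAgreement.inputA_of_prop24i`, `StableCurveAgreement.h23v`). [claim: Mochizuki2012, status: disputed] -/
theorem cor24_i'_of_agreements (A : W.StableCurveAgreement C Dsc) (h24i : Dsc.Prop24i) (hIker : I ≤ W.aug.ker)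
    (hΛ : ∃ Λ : Subgroup Dsc.DeltaTp, IsCompact (Λ : Set Dsc.DeltaTp) ∧ Λ ≠ ⊥ ∧ IsProSigma Dsc.graph.Sigma Λ ∧
      (Λ.map Dsc.DeltaTp.subtype).map Dsc.ιX ≤ (I.subgroupOf W.pmHat).map A.eHat.toMonoidHom)
    (Dic : ∀ H : Subgroup P, Cor24_family Dec Ld H →
      ∃ (D' : StableCurveTemperedData.{u}) (A' : W.StableCurveAgreement C D'),
        A'.SubgraphDictionary H ∧ D'.Cor23ii ∧ D'.Cor23v)
    (h23vi : ∀ H : Subgroup P, Cor24_family Dec Ld H →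
      ∀ γ' : W.Corhat, γ' ∈ W.piPM ⊓ W.aug.ker →
        I.map (MulAut.conj γ').toMonoidHom ≤ W.pmBox H → γ' ∈ closure (W.deltaPmBox H : Set W.Corhat)) :
    Literature.IUT.HodgeArakelov.Cor24_i' Dec W C Ld I :=
  cor24_i'_of_inputs Dec W C Ld I (A.inputA_of_prop24i h24i hIker hΛ) fun H hH => by
    obtain ⟨D', A', hDic, h23ii, h23vD⟩ := Dic H hH
    exact ⟨h23vi H hH, A'.h23v hDic h23ii h23vD⟩

end Assembly

end Literature.IUT.HodgeArakelov
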